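import Literature.Analysis.FluidPDE.AdaptedBackwardKernel
import Literature.Analysis.FluidPDE.SpaceTimeCalculus
import Literature.Analysis.FluidPDE.WholeSpaceIBP
import Literature.Analysis.FluidPDE.RadialSmoothCutoff

/-!
# Crux `AdaptedKernelExists` (stmt-NavierStokesRegularity-2956), line `nash-entropy-last-block`:
  UNIT MASS for STUB `stub_kernelPackaging`

Helper file (lands `--supports stmt-NavierStokesRegularity-2956`) for the registered stub
`stub_kernelPackaging` of the line's skeleton (packaging a smooth positive classical solution `g`
of the backward equation `∂ₜg + b·∇g + νΔg = 0` on the open slab `Ioo ta T × ℝ³`, equal to the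
backward heat kernel `Γ = backwardHeatKernel ν T x₀` on `Ico Ta T`, into an adapted backward
kernel). This file proves the conservation of MASS `∫ g(t, ·) = 1` on `Ioo ta T` for a smooth,
bounded, divergence-free drift `b`, given integrability of the slices with a uniform bound
`∫ g(s, ·) ≤ K₁` (supplied by the Gaussian envelope of the companion file `…PackagingEnvelope`):

* `kernelPackaging_integral_mul_fderiv_apply`, `kernelPackaging_integral_mul_laplacian`: the
  transport identity `∫ ψ (b·∇G) = −∫ G (b·∇ψ)` (`div b = 0`) and Green's identity
  `∫ ψ ΔG = ∫ G Δψ` for a compactly supported test function `ψ` (tree: `WholeSpaceIBP`);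
* `kernelPackaging_hasDerivAt_pairing`: `d/ds ∫ ψ g(s) = ∫ g(s) (b(s)·∇ψ) − ν ∫ g(s) Δψ`
  (differentiation under the integral sign, `hasDerivAt_integral_of_support_subset`, the
  equation, and the two identities);
* `kernelPackaging_abs_pairingDeriv_le`: with the radial cut-off `ψ_R` of `RadialSmoothCutoff`
  (`‖∇ψ_R‖ ≤ c₁/R`, `|Δψ_R| ≤ c₂/R²`) the derivative is `≤ (Bc₁/R + νc₂/R²) K₁`;
* `kernelPackaging_mass` / `stub_kernelPackaging_mass` (registered sub-goal): `∫ g(t, ·) = 1` for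
  `t ∈ Ioo ta T` (mean value on `[t, Ta]`, `∫ ψ_R Γ(Ta) → 1` and `∫ ψ_R g(t) → ∫ g(t)` as
  `R → ∞` by dominated convergence).
-/

noncomputable section

open MeasureTheory Set Filter Topology Metric Function Real
open scoped Laplacian ContDiff
open Literature.Analysis.FluidPDE Literature.Analysis

namespace Summit.NavierStokesRegularity.NavierStokesRegularity.Theorems.AdaptedKernelExists.NashEntropyLastBlock

/-! ### Integration by parts against a compactly supported test function -/

/-- **Transport identity**: for `C¹` functions `G, ψ` on `ℝ³`, `ψ` compactly supported, and a
divergence-free `C¹` field `V`, `∫ ψ (V·∇G) = −∫ G (V·∇ψ)` (tree: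
`integral_inner_convect_add_eq_zero`). -/
theorem kernelPackaging_integral_mul_fderiv_apply {G ψ : EuclideanSpace ℝ (Fin 3) → ℝ}
    {V : EuclideanSpace ℝ (Fin 3) → EuclideanSpace ℝ (Fin 3)} (hG : ContDiff ℝ 1 G)
    (hψ : ContDiff ℝ 1 ψ) (hψc : HasCompactSupport ψ) (hV : ContDiff ℝ 1 V)
    (hdiv : VectorCalculus.IsDivFree V) :
    ∫ x, ψ x * fderiv ℝ G x (V x) = -∫ x, G x * fderiv ℝ ψ x (V x) := by
  have h := integral_inner_convect_add_eq_zero (F' := ℝ) hV hG hψ hψc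
  have hinner : ∀ a c : ℝ, @inner ℝ ℝ _ a c = a * c := fun a c => by simp [mul_comm]
  have hd : ∀ x, VectorCalculus.divergence V x = 0 := hdiv
  simp only [convect_apply, hinner, hd, zero_mul, integral_zero, add_zero] at h
  have e : ∫ x, ψ x * fderiv ℝ G x (V x) = ∫ x, fderiv ℝ G x (V x) * ψ x :=
    integral_congr_ae (Eventually.of_forall fun x => mul_comm _ _)
  rw [e]
  linarith

/-- **Green's identity**: for `C²` functions `G, ψ` on `ℝ³`, `ψ` compactly supported,
`∫ ψ ΔG = ∫ G Δψ` (tree: `integral_inner_laplacian_add_eq_zero`, twice). -/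
theorem kernelPackaging_integral_mul_laplacian {G ψ : EuclideanSpace ℝ (Fin 3) → ℝ}
    (hG : ContDiff ℝ 2 G) (hψ : ContDiff ℝ 2 ψ) (hψc : HasCompactSupport ψ) :
    ∫ x, ψ x * (Δ G) x = ∫ x, G x * (Δ ψ) x := by
  have h1 := integral_inner_laplacian_add_eq_zero (stdOrthonormalBasis ℝ (EuclideanSpace ℝ (Fin 3)))
    (F' := ℝ) hG (hψ.of_le one_le_two) (Or.inr hψc)
  have h2 := integral_inner_laplacian_add_eq_zero (stdOrthonormalBasis ℝ (EuclideanSpace ℝ (Fin 3)))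
    (F' := ℝ) hψ (hG.of_le one_le_two) (Or.inl hψc)
  have hinner : ∀ a c : ℝ, @inner ℝ ℝ _ a c = a * c := fun a c => by simp [mul_comm]
  simp only [hinner] at h1 h2
  have hs : ∑ i, ∫ x, fderiv ℝ G x (stdOrthonormalBasis ℝ (EuclideanSpace ℝ (Fin 3)) i) *
      fderiv ℝ ψ x (stdOrthonormalBasis ℝ (EuclideanSpace ℝ (Fin 3)) i) =
      ∑ i, ∫ x, fderiv ℝ ψ x (stdOrthonormalBasis ℝ (EuclideanSpace ℝ (Fin 3)) i) *
        fderiv ℝ G x (stdOrthonormalBasis ℝ (EuclideanSpace ℝ (Fin 3)) i) :=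
    Finset.sum_congr rfl fun i _ => integral_congr_ae (Eventually.of_forall fun x => mul_comm _ _)
  have e1 : ∫ x, ψ x * (Δ G) x = ∫ x, (Δ G) x * ψ x :=
    integral_congr_ae (Eventually.of_forall fun x => mul_comm _ _)
  have e2 : ∫ x, G x * (Δ ψ) x = ∫ x, (Δ ψ) x * G x :=
    integral_congr_ae (Eventually.of_forall fun x => mul_comm _ _)
  rw [e1, e2]
  linarith

/-! ### The pairing `s ↦ ∫ ψ g(s)` and its derivative -/

/-- **Derivative of the pairing.** For `b` jointly smooth and divergence free on `Ico ta T`, `g`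
jointly smooth on `Ioo ta T` solving `∂ₜg + b·∇g + νΔg = 0` there, and a smooth compactly
supported `ψ`: `d/ds ∫ ψ g(s) = ∫ g(s) (b(s)·∇ψ) − ν ∫ g(s) Δψ` at every `s ∈ Ioo ta T`
(differentiation under the integral on the compact support, the equation, the transport and Green
identities). -/
theorem kernelPackaging_hasDerivAt_pairing {ν ta T : ℝ}
    {b : ℝ → EuclideanSpace ℝ (Fin 3) → EuclideanSpace ℝ (Fin 3)}
    {g : ℝ → EuclideanSpace ℝ (Fin 3) → ℝ} {ψ : EuclideanSpace ℝ (Fin 3) → ℝ}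
    (hb : IsSmoothSpaceTimeOn (Ico ta T) b) (hdiv : ∀ t ∈ Ico ta T, VectorCalculus.IsDivFree (b t))
    (hg : IsSmoothSpaceTimeOn (Ioo ta T) g)
    (heq : ∀ t ∈ Ioo ta T, ∀ x,
      deriv (fun s => g s x) t + fderiv ℝ (g t) x (b t x) + ν * (Δ (g t)) x = 0)
    (hψ : ContDiff ℝ ∞ ψ) (hψc : HasCompactSupport ψ) {s : ℝ} (hs : s ∈ Ioo ta T) :
    HasDerivAt (fun r => ∫ z, ψ z * g r z)
      ((∫ z, g s z * fderiv ℝ ψ z (b s z)) - ν * ∫ z, g s z * (Δ ψ) z) s := by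
  -- differentiation under the integral sign
  have hΦ : IsSmoothSpaceTimeOn (Ioo ta T) fun r z => ψ z * g r z :=
    (isSmoothSpaceTimeOn_const_time hψ _).mul hg
  have hsupp : ∀ r ∈ Ioo ta T, ∀ z ∉ tsupport ψ, ψ z * g r z = 0 := fun r _ z hz => by
    rw [image_eq_zero_of_notMem_tsupport hz, zero_mul]
  have h1 := hasDerivAt_integral_of_support_subset (μ := volume) isOpen_Ioo hΦ hψc hsupp hs
  refine h1.congr_deriv ?_
  -- the time derivative through the equation
  have hd : ∀ z, deriv (fun r => ψ z * g r z) s =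
      ψ z * (-(fderiv ℝ (g s) z (b s z) + ν * (Δ (g s)) z)) := by
    intro z
    rw [((hg.hasDerivAt_timeLine isOpen_Ioo hs z).const_mul (ψ z)).deriv]
    congr 1
    linarith [heq s hs z]
  rw [integral_congr_ae (Eventually.of_forall hd)]
  -- integration by parts
  have hs' : s ∈ Ico ta T := Ioo_subset_Ico_self hs
  have hG : ContDiff ℝ ∞ (g s) := hg.contDiff_slice hs
  have hV : ContDiff ℝ ∞ (b s) := hb.contDiff_slice hs'
  have hG1 : ContDiff ℝ 1 (g s) := hG.of_le (by norm_cast)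
  have hG2 : ContDiff ℝ 2 (g s) := hG.of_le (by norm_cast)
  have hV1 : ContDiff ℝ 1 (b s) := hV.of_le (by norm_cast)
  have hψ1 : ContDiff ℝ 1 ψ := hψ.of_le (by norm_cast)
  have hψ2 : ContDiff ℝ 2 ψ := hψ.of_le (by norm_cast)
  have ht := kernelPackaging_integral_mul_fderiv_apply hG1 hψ1 hψc hV1 (hdiv s hs')
  have hl := kernelPackaging_integral_mul_laplacian hG2 hψ2 hψc
  have hi1 : Integrable fun z => ψ z * fderiv ℝ (g s) z (b s z) :=
    (hψ.continuous.mul ((hG1.continuous_fderiv one_ne_zero).clm_apply hV.continuous))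
      |>.integrable_of_hasCompactSupport hψc.mul_right
  have hi2 : Integrable fun z => ψ z * (Δ (g s)) z :=
    (hψ.continuous.mul (continuous_laplacian hG2)).integrable_of_hasCompactSupport hψc.mul_right
  have e : (fun z => ψ z * (-(fderiv ℝ (g s) z (b s z) + ν * (Δ (g s)) z))) =
      fun z => -(ψ z * fderiv ℝ (g s) z (b s z)) - ν * (ψ z * (Δ (g s)) z) := by
    funext z; ring
  have hi1' : Integrable fun z => -(ψ z * fderiv ℝ (g s) z (b s z)) := hi1.neg
  rw [e, integral_sub hi1' (hi2.const_mul ν), integral_neg, integral_const_mul, ht, hl]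
  ring

/-- **Bound of the derivative of the pairing.** If `0 ≤ G`, `∫ G ≤ K₁`, `‖V‖ ≤ B`,
`‖∇ψ‖ ≤ c₁/R` and `|Δψ| ≤ c₂/R²`, then
`|∫ G (V·∇ψ) − ν ∫ G Δψ| ≤ (B c₁/R + ν c₂/R²) K₁`. -/
theorem kernelPackaging_abs_pairingDeriv_le {ν B K₁ c₁ c₂ R : ℝ}
    {G ψ : EuclideanSpace ℝ (Fin 3) → ℝ} {V : EuclideanSpace ℝ (Fin 3) → EuclideanSpace ℝ (Fin 3)}
    (hν : 0 ≤ ν) (hG0 : ∀ z, 0 ≤ G z) (hGi : Integrable G) (hGm : ∫ z, G z ≤ K₁)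
    (hV : ∀ z, ‖V z‖ ≤ B) (hψ1 : ∀ z, ‖fderiv ℝ ψ z‖ ≤ c₁ / R)
    (hψ2 : ∀ z, |(Δ ψ) z| ≤ c₂ / R ^ 2) :
    |(∫ z, G z * fderiv ℝ ψ z (V z)) - ν * ∫ z, G z * (Δ ψ) z| ≤
      (B * c₁ / R + ν * (c₂ / R ^ 2)) * K₁ := by
  have hc₁ : 0 ≤ c₁ / R := (norm_nonneg _).trans (hψ1 0)
  have hc₂ : 0 ≤ c₂ / R ^ 2 := (abs_nonneg _).trans (hψ2 0)
  have e1 : |∫ z, G z * fderiv ℝ ψ z (V z)| ≤ B * c₁ / R * K₁ := by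
    have hpt : ∀ z, ‖G z * fderiv ℝ ψ z (V z)‖ ≤ G z * (c₁ / R * B) := fun z => by
      rw [norm_mul, Real.norm_of_nonneg (hG0 z)]
      refine mul_le_mul_of_nonneg_left ?_ (hG0 z)
      calc ‖fderiv ℝ ψ z (V z)‖ ≤ ‖fderiv ℝ ψ z‖ * ‖V z‖ := ContinuousLinearMap.le_opNorm _ _
        _ ≤ c₁ / R * B := mul_le_mul (hψ1 z) (hV z) (norm_nonneg _) hc₁
    have h := norm_integral_le_of_norm_le (hGi.mul_const (c₁ / R * B)) (Eventually.of_forall hpt)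
    rw [Real.norm_eq_abs, integral_mul_const] at h
    refine h.trans ?_
    have hB : 0 ≤ B := (norm_nonneg _).trans (hV 0)
    calc (∫ z, G z) * (c₁ / R * B) ≤ K₁ * (c₁ / R * B) :=
          mul_le_mul_of_nonneg_right hGm (by positivity)
      _ = B * c₁ / R * K₁ := by ring
  have e2 : |∫ z, G z * (Δ ψ) z| ≤ c₂ / R ^ 2 * K₁ := by
    have hpt : ∀ z, ‖G z * (Δ ψ) z‖ ≤ G z * (c₂ / R ^ 2) := fun z => by
      rw [norm_mul, Real.norm_of_nonneg (hG0 z), Real.norm_eq_abs]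
      exact mul_le_mul_of_nonneg_left (hψ2 z) (hG0 z)
    have h := norm_integral_le_of_norm_le (hGi.mul_const (c₂ / R ^ 2)) (Eventually.of_forall hpt)
    rw [Real.norm_eq_abs, integral_mul_const] at h
    refine h.trans ?_
    calc (∫ z, G z) * (c₂ / R ^ 2) ≤ K₁ * (c₂ / R ^ 2) := mul_le_mul_of_nonneg_right hGm hc₂
      _ = c₂ / R ^ 2 * K₁ := by ring
  calc |(∫ z, G z * fderiv ℝ ψ z (V z)) - ν * ∫ z, G z * (Δ ψ) z|
      ≤ |∫ z, G z * fderiv ℝ ψ z (V z)| + |ν * ∫ z, G z * (Δ ψ) z| := abs_sub _ _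
    _ = |∫ z, G z * fderiv ℝ ψ z (V z)| + ν * |∫ z, G z * (Δ ψ) z| := by
        rw [abs_mul, abs_of_nonneg hν]
    _ ≤ B * c₁ / R * K₁ + ν * (c₂ / R ^ 2 * K₁) := by gcongr
    _ = (B * c₁ / R + ν * (c₂ / R ^ 2)) * K₁ := by ring

/-! ### Conservation of mass -/

/-- **Unit mass.** Let `b` be jointly smooth, divergence free and bounded by `B` on `Ico ta T`,
`g ≥ 0` jointly smooth on `Ioo ta T` with `∂ₜg + b·∇g + νΔg = 0` there, `g = Γ` on `Ico Ta T`
(`ta < Ta < T`), and suppose the slices `g(s, ·)`, `s ∈ Ioo ta T`, are integrable with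
`∫ g(s, ·) ≤ K₁`. Then `∫ g(t, ·) = 1` for every `t ∈ Ioo ta T`. Proof: for `t ≥ Ta` this is
`integral_backwardHeatKernel`; for `t < Ta`, with the radial cut-offs `ψ_R`,
`|∫ ψ_R g(Ta) − ∫ ψ_R g(t)| ≤ (Ta − t)(Bc₁/R + νc₂/R²)K₁ → 0`, while `∫ ψ_R g(Ta) → ∫ Γ(Ta) = 1`
and `∫ ψ_R g(t) → ∫ g(t)` (dominated convergence). -/
theorem kernelPackaging_mass {ν ta Ta T B K₁ : ℝ}
    {b : ℝ → EuclideanSpace ℝ (Fin 3) → EuclideanSpace ℝ (Fin 3)} {x₀ : EuclideanSpace ℝ (Fin 3)}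
    {g : ℝ → EuclideanSpace ℝ (Fin 3) → ℝ} (hν : 0 < ν) (hta : ta < Ta) (hTa : Ta < T)
    (hb : IsSmoothSpaceTimeOn (Ico ta T) b) (hdiv : ∀ t ∈ Ico ta T, VectorCalculus.IsDivFree (b t))
    (hbB : ∀ t ∈ Ico ta T, ∀ x, ‖b t x‖ ≤ B) (hg : IsSmoothSpaceTimeOn (Ioo ta T) g)
    (heq : ∀ t ∈ Ioo ta T, ∀ x,
      deriv (fun s => g s x) t + fderiv ℝ (g t) x (b t x) + ν * (Δ (g t)) x = 0)
    (hΓ : ∀ t ∈ Ico Ta T, g t = backwardHeatKernel ν T x₀ t)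
    (hpos : ∀ t ∈ Ioo ta T, ∀ x, 0 ≤ g t x) (hgi : ∀ t ∈ Ioo ta T, Integrable (g t))
    (hgm : ∀ t ∈ Ioo ta T, ∫ x, g t x ≤ K₁) {t : ℝ} (ht : t ∈ Ioo ta T) :
    ∫ x, g t x = 1 := by
  rcases le_or_gt Ta t with htT | htT
  · rw [hΓ t ⟨htT, ht.2⟩]
    exact integral_backwardHeatKernel hν x₀ ht.2
  -- the radial cut-offs `ψ R`
  obtain ⟨c₁, -, hc₁b⟩ := exists_norm_fderiv_smoothTransition_cutoff_le (E := EuclideanSpace ℝ (Fin 3))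
  obtain ⟨c₂, -, hc₂b⟩ := exists_abs_laplacian_smoothTransition_cutoff_le
    (E := EuclideanSpace ℝ (Fin 3))
  set ψ : ℝ → EuclideanSpace ℝ (Fin 3) → ℝ :=
    fun R z => Real.smoothTransition (2 - ‖z‖ ^ 2 / R ^ 2) with hψ
  have hψs : ∀ R, ContDiff ℝ ∞ (ψ R) := fun R => contDiff_smoothTransition_cutoff (n := ⊤) R
  have hψc : ∀ R, 0 < R → HasCompactSupport (ψ R) := fun R hR =>
    hasCompactSupport_smoothTransition_cutoff hR
  have hψ0 : ∀ R z, 0 ≤ ψ R z := fun R z => smoothTransition_cutoff_nonneg R z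
  have hψle : ∀ R z, ψ R z ≤ 1 := fun R z => smoothTransition_cutoff_le_one R z
  have hψone : ∀ R, 0 < R → ∀ z : EuclideanSpace ℝ (Fin 3), ‖z‖ ≤ R → ψ R z = 1 :=
    fun R hR z hz => smoothTransition_cutoff_eq_one hR hz
  have hTa' : Ta ∈ Ioo ta T := ⟨hta, hTa⟩
  have hIcc : Icc t Ta ⊆ Ioo ta T := fun s hs => ⟨ht.1.trans_le hs.1, hs.2.trans_lt hTa⟩
  -- mean value on `[t, Ta]`
  have hmv : ∀ R, 0 < R → ‖(∫ z, ψ R z * g Ta z) - ∫ z, ψ R z * g t z‖ ≤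
      (B * c₁ / R + ν * (c₂ / R ^ 2)) * K₁ * (Ta - t) := by
    intro R hR
    refine norm_image_sub_le_of_norm_deriv_le_segment' (f := fun r => ∫ z, ψ R z * g r z)
      (fun s hs => (kernelPackaging_hasDerivAt_pairing hb hdiv hg heq (hψs R) (hψc R hR)
        (hIcc hs)).hasDerivWithinAt) (fun s hs => ?_) Ta (right_mem_Icc.2 htT.le)
    rw [Real.norm_eq_abs]
    have hs' := hIcc (Ico_subset_Icc_self hs)
    exact kernelPackaging_abs_pairingDeriv_le hν.le (hpos s hs') (hgi s hs') (hgm s hs')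
      (hbB s (Ioo_subset_Ico_self hs')) (hc₁b R hR) (hc₂b R hR)
  -- the limits `R → ∞`
  have hlim : ∀ s ∈ Ioo ta T,
      Tendsto (fun R => ∫ z, ψ R z * g s z) atTop (𝓝 (∫ z, g s z)) := by
    intro s hs
    refine tendsto_integral_filter_of_dominated_convergence (fun z => g s z) ?_ ?_ (hgi s hs) ?_
    · exact Eventually.of_forall fun R =>
        ((hψs R).continuous.mul (hg.contDiff_slice hs).continuous).aestronglyMeasurable
    · refine Eventually.of_forall fun R => Eventually.of_forall fun z => ?_
      rw [norm_mul, Real.norm_of_nonneg (hψ0 R z), Real.norm_of_nonneg (hpos s hs z)]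
      exact mul_le_of_le_one_left (hpos s hs z) (hψle R z)
    · refine Eventually.of_forall fun z => ?_
      have hev : (fun R => ψ R z * g s z) =ᶠ[atTop] fun _ => g s z := by
        filter_upwards [eventually_ge_atTop ‖z‖, eventually_gt_atTop (0:ℝ)] with R hR hR0
        rw [hψone R hR0 z hR, one_mul]
      exact (tendsto_congr' hev).2 tendsto_const_nhds
  have hA : Tendsto (fun R => (∫ z, ψ R z * g Ta z) - ∫ z, ψ R z * g t z) atTop
      (𝓝 (1 - ∫ z, g t z)) := by
    have e : ∫ z, g Ta z = 1 := by
      rw [hΓ Ta ⟨le_rfl, hTa⟩]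
      exact integral_backwardHeatKernel hν x₀ hTa
    have h1 := hlim Ta hTa'
    rw [e] at h1
    exact h1.sub (hlim t ht)
  have hB : Tendsto (fun R => (∫ z, ψ R z * g Ta z) - ∫ z, ψ R z * g t z) atTop (𝓝 0) := by
    refine squeeze_zero_norm'
      (a := fun R => (B * c₁ / R + ν * (c₂ / R ^ 2)) * K₁ * (Ta - t)) ?_ ?_
    · filter_upwards [eventually_gt_atTop (0:ℝ)] with R hR using hmv R hR
    · have h1 : Tendsto (fun R : ℝ => B * c₁ / R) atTop (𝓝 0) := by
        simpa [div_eq_mul_inv] using tendsto_inv_atTop_zero.const_mul (B * c₁)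
      have h2 : Tendsto (fun R : ℝ => ν * (c₂ / R ^ 2)) atTop (𝓝 0) := by
        have := ((tendsto_pow_atTop (n := 2) (by norm_num)).inv_tendsto_atTop).const_mul (ν * c₂)
        simpa [div_eq_mul_inv, mul_assoc] using this
      simpa using ((h1.add h2).mul_const K₁).mul_const (Ta - t)
  have := tendsto_nhds_unique hA hB
  linarith

/-- **Registered sub-goal `stub_kernelPackaging_mass`** (the mass half of STUB
`stub_kernelPackaging`): unit mass `∫ g(t, ·) = 1` on `Ioo ta T` for the smooth nonnegative
classical solution `g` equal to `Γ` on `Ico Ta T`, with integrable slices of mass `≤ K₁`, and a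
smooth bounded divergence-free drift. -/
theorem stub_kernelPackaging_mass :
    ∀ (ν ta Ta T B K₁ : ℝ) (b : ℝ → EuclideanSpace ℝ (Fin 3) → EuclideanSpace ℝ (Fin 3)) (x₀ : EuclideanSpace ℝ (Fin 3)) (g : ℝ → EuclideanSpace ℝ (Fin 3) → ℝ), 0 < ν → ta < Ta → Ta < T → IsSmoothSpaceTimeOn (Ico ta T) b → (∀ t ∈ Ico ta T, VectorCalculus.IsDivFree (b t)) → (∀ t ∈ Ico ta T, ∀ x, ‖b t x‖ ≤ B) → IsSmoothSpaceTimeOn (Ioo ta T) g → (∀ t ∈ Ioo ta T, ∀ x, deriv (fun s => g s x) t + fderiv ℝ (g t) x (b t x) + ν * (Δ (g t)) x = 0) → (∀ t ∈ Ico Ta T, g t = backwardHeatKernel ν T x₀ t) → (∀ t ∈ Ioo ta T, ∀ x, 0 ≤ g t x) → (∀ t ∈ Ioo ta T, Integrable (g t)) → (∀ t ∈ Ioo ta T, ∫ x, g t x ≤ K₁) → ∀ t ∈ Ioo ta T, ∫ x, g t x = 1 := by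
  intro ν ta Ta T B K₁ b x₀ g hν hta hTa hb hdiv hbB hg heq hΓ hpos hgi hgm t ht
  exact kernelPackaging_mass hν hta hTa hb hdiv hbB hg heq hΓ hpos hgi hgm ht

end Summit.NavierStokesRegularity.NavierStokesRegularity.Theorems.AdaptedKernelExists.NashEntropyLastBlock

end
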